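import Summits.BirchSwinnertonDyer.BirchSwinnertonDyer.Theorems.PrintCf2SplitBadTwistCurrency
import Literature.NumberTheory.EllipticCurves.BSDQuotientOverNumberField
import Literature.NumberTheory.EllipticCurves.DeShalit1987.KatzTwoVariablePAdicLFunction
import HarnessLib

set_option linter.dupNamespace false
set_option autoImplicit false

noncomputable section

open scoped Classical

open WeierstrassCurve Literature.NumberTheory.EllipticCurves Literature.NumberTheory.EllipticCurves.Rank1Residual
  Literature.NumberTheory.GaloisRepresentations Literature.NumberTheory.EllipticCurves.DeShalit1987

namespace Summit.BirchSwinnertonDyer.BirchSwinnertonDyer.Cruxes.SplitBadTwoRankOneOfFacts.TowerTranslate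

open Summit.BirchSwinnertonDyer.BirchSwinnertonDyer.Theses.PrintCf2

/-- First lemma of the idea `tower-translate-two-mod-eight` (IN PRINT / elementary): on the sub-class
`d ≡ 2 (mod 8)` of Cf2 the member `W' ≅ 49a1^{(d)}` is the quadratic twist BY `2` of the GOOD twist
`A' ≅ 49a1^{(d/2)}` (`d/2 ≡ 1 (mod 4)`), and `A'` has good (ordinary: `2` splits in `ℚ(√−7)`) reduction at `2`. -/
theorem stub_towerTranslateFactorisation :
    ∀ (d' : ℤ), Squarefree d' → d' % 4 = 1 →
      ∀ (A' W' : WeierstrassCurve ℚ) [A'.IsElliptic] [A'.IsGloballyMinimal] [W'.IsElliptic] [W'.IsGloballyMinimal]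
        (C C' : VariableChange ℚ),
        C • A' = cm7.quadraticTwist (d' : ℚ) → C' • W' = cm7.quadraticTwist ((2 * d' : ℤ) : ℚ) →
        Good A' 2 ∧ A'.HasCM ∧ ∃ C₂ : VariableChange ℚ, C₂ • A'.quadraticTwist (2 : ℚ) = W' := by
  sorry

/-- The Weil-restriction reading through the FIRST CYCLOTOMIC LAYER `ℚ(√2)` (closable modulo the tree's named fact
`Milne1972.bsdQuotient_baseChange_quadratic_anyModel`, as `RamifiedHeegnerPairRungOverK.bsdpOver_baseChange_of_pair` read
backwards; it needs `BSD(A', 2)`, hence only for `r_an(A') ≤ 1` is the right-hand input in print — LTYZ 2025 Thm 1.1 (ii) /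
Burungale–Flach 2024): `BSD(A',2) ∧ BSD₂(A'/ℚ(√2)) → BSD(W',2)`. -/
theorem stub_weilRestrictionSqrtTwo
    (hGZK : Literature.NumberTheory.EllipticCurves.rank_eq_analyticRank_of_analyticRank_le_one)
    (hE : WeierstrassCurve.hasEntireLFunction_rat) :
    ∀ (A' W' : WeierstrassCurve ℚ) [A'.IsElliptic] [A'.IsGloballyMinimal] [W'.IsElliptic] [W'.IsGloballyMinimal],
      (∃ C₂ : VariableChange ℚ, C₂ • A'.quadraticTwist (2 : ℚ) = W') → A'.analyticRank ≤ 1 → W'.analyticRank = 1 →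
      ∀ (F : Type) [Field F] [NumberField F] (θ : F), Module.finrank ℚ F = 2 → θ ^ 2 = (2 : F) →
        BSDp A' 2 → BSDpOver (A'.baseChange F) 2 → BSDp W' 2 := by
  sorry

end Summit.BirchSwinnertonDyer.BirchSwinnertonDyer.Cruxes.SplitBadTwoRankOneOfFacts.TowerTranslate
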